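import Mathlib
import HarnessLib
import Summits.AnomalousDissipation.AnomalousDissipation.Theses.LimitingAbsorption
import Literature.Analysis.FluidPDE.PassiveScalar
import Literature.Analysis.FluidPDE.PassiveScalarForced
import Summits.AnomalousDissipation.AnomalousDissipation.Theorems.LimitingAbsorptionUniformRelaxationWitnessStubMeanEnergyGlue
import Summits.AnomalousDissipation.AnomalousDissipation.Theorems.LimitingAbsorptionUniformRelaxationWitnessPeriodicTransfer
import Summits.AnomalousDissipation.AnomalousDissipation.Theorems.LimitingAbsorptionKinematicSteadySourceLawToolkit
import Summits.AnomalousDissipation.AnomalousDissipation.Theorems.LimitingAbsorptionRelaxationBoundsInventoryShift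

/-!
# Line `Sketch` (ideator 2, card `sign-coherent-two-phase-stirring`) — skeleton for the crux
# `LimitingAbsorption.UniformRelaxationWitness` (stmt-AnomalousDissipation-2937)

Lead: prover-line-stmt-AnomalousDissipation-2937-0 (2026-08-16). Source sketch:
`Cruxes/UniformRelaxationWitness/SketchIdeator2.lean`; card `Ideas/sign-coherent-two-phase-stirring.md`.

THE CRUX (`UniformRelaxationWitness`, = thesis X of route LimitingAbsorption): a steady smooth
solenoidal mean-zero planar force `g`, a smooth mean-zero profile `h`, `ν_j → 0` and global
Leray–Hopf solutions `v_j` of 2-D Navier–Stokes (force `g`, locally bounded, `meanEnergy ≤ E`)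
with `(U_h)`: ν-UNIFORM, PHASE-UNIFORM exponential `L²` relaxation of every weak scalar released
with datum `h`, and `(ABS)`: a ν-uniform floor `ε` on the dissipation of the `h`-sourced scalar.

THE LINE. Witnesses are sought among EXACT TIME-PERIODIC, POINT-SYMMETRIC Navier–Stokes states
(`RecurrentSymmetricStates`, the transfer class `C⁺` of the card): for a `T_j`-periodic drift the
phase-uniform clause over ALL phases `s ≥ 0` is the clause over ONE period (`periodicPhaseReduction`,
PROVED: the equation released at phase `s` is literally the one released at `s mod T_j`), and a
POINTWISE energy bound `∫‖v_j(t)‖² ≤ E` gives `meanEnergy v_j ≤ max E 0` (`stub_meanEnergyGlue`,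
bookkeeping over `longTimeAvgSup`). Hence `C⁺ → X` (`UniformRelaxationWitness_of`, kernel-closed
modulo the stubs it invokes).

STUBS (registered; sorries live ONLY in `stub_*`):
* `stub_recurrentSymmetricStatesOne : RecurrentSymmetricStatesOne` — OPEN, HARDEST, held by the
  lead. RESHAPED (v3, 2026-08-16) from the card's `RecurrentSymmetricStates`: the one-period
  relaxation clause is now asked for ONE weak solution per (level, phase, horizon) —
  `RelaxesFromOneSolution` — instead of for every weak solution; the upgrade to the card's
  `∀`-form is PROVED glue (`relaxation_allSolutions_of_oneSolution`: bounded-drift uniqueness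
  `KinematicSteadySourceLaw.ae_eq_of_memLp_top` + time-shift of the `L^∞` bound,
  `LapInventory.memLp_top_stLift_comp_const_add`), and `recurrentSymmetricStates_of_one` recovers
  the card's `C⁺` verbatim. What remains in the stub is content ⊋ crux: existence of exact
  recurrent point-symmetric 2-D NS states along `ν → 0` (sign-coherent thin vorticity phases,
  enstrophy `≍ log²(1/ν)`, Seis-sharp) with pointwise bounded energy, ν-uniform one-period decay of
  the energy solution released with the fixed odd profile, and the absorbed-power floor — an
  existence problem in PDE (beyond printed KAM-for-Euler / UPO continuation), not a formalisation
  debt.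
* `stub_meanEnergyGlue` — pointwise `∫⁻ ‖v t‖ₑ² ≤ ofReal E` on `t ≥ 0` ⇒ `meanEnergy v ≤ max E 0`.
  CLOSED (wave 1, p96702: `Theorems/LimitingAbsorptionUniformRelaxationWitnessStubMeanEnergyGlue.lean`).
* registered sub-goal `relaxation_allPhases_of_periodic` (periodic phase reduction, = the proved
  `periodicPhaseReduction` below in `∀`-form) — CLOSED (p97288:
  `Theorems/LimitingAbsorptionUniformRelaxationWitnessPeriodicTransfer.lean`, together with the
  conditional transfer `uniformRelaxationWitness_of_periodicFamily`: periodic LH family + one-period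
  `(U_h)` + floor ⇒ crux, no symmetry and no period cap needed).

## Disproof used (`Cruxes/UniformRelaxationWitness/Disproof.lean`, cdisprove cycle 1, read 2026-08-16T11:30Z)
* Verdict there: no kill, no misstatement; `¬X` ⇔ (in practice) a `j`-uniform linear windowed strain
  budget for bounded-energy steadily forced planar LH families — not in print (energy balance `ν⟨‖∇v‖²⟩ ≤
  ‖g‖E^{1/2}`, Alexakis–Doering `⟨‖∇v‖²⟩ ≲ ν^{-1/2}`; a kill needs `o(log²(1/ν))`).
* `_false_without_<H>` theorems HONOURED by this line's stub (they say what any proof must use):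
  `uniformRelaxationWitness_false_with_zero_profile` (h ≠ 0 — our h is odd and carries the floor),
  `…_false_without_superlinearEnstrophy / unboundedEnstrophy / superlinearMeanEnstrophy` (Seis floor:
  witnesses need windowed enstrophy `≳ γ² log²(1/ν_j)`), and on the line itself
  `recurrentStates_false_without_unboundedPeriodStrain` (exact `T_j`-periodic states with pointwise
  energy `≤ E`, `T_j ≤ T₀` must have per-period mean strain `T_j⁻¹∫‖∇v_j‖₂ → ∞`, sharp `≳ γ log(1/ν_j)`):
  the card's states carry vorticity `±K log(1/ν)` on thin phases, enstrophy `K² log²` — consistent, and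
  `C⁺₁` caps only POINTWISE ENERGY, never enstrophy/strain.
* `uniformRelaxationWitness_false_of_not_relaxingFamily : ¬RelaxingFamily → ¬X`: r3's negative knowledge
  binds this line too (our stub implies `RelaxingFamily` restricted to periodic symmetric states).
* Near-misses (sorried there): `noUniversalRelaxer` (N1: an X-stirring cannot also relax `curl g`) — the
  card's parity/sign-coherence design is built exactly to remember `curl g` while forgetting `h`;
  `singleShell_dead` — `g` must be multi-shell / off the first shell (card: `g = sin(4πx₂)e₁`-type, odd).
* No `-- Targets` section yet (no stub of this line was posted as STUCK with a goal state before this cycle).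
-/

open MeasureTheory Set Filter
open scoped ENNReal NNReal

noncomputable section

set_option linter.dupNamespace false

namespace Summit.AnomalousDissipation.AnomalousDissipation.Cruxes.UniformRelaxationWitness.Sketch

open Literature.Analysis.FluidPDE Literature.Analysis.FunctionSpaces
open Summit.AnomalousDissipation.AnomalousDissipation.Theses.LimitingAbsorption

/-- The flat two-torus (local notation). -/
local notation "𝕋²" => UnitAddTorus (Fin 2)
/-- Planar velocity values (local notation). -/
local notation "E²" => EuclideanSpace ℝ (Fin 2)

/-! ## Objects of the line -/

/-- The `(U_h)` clause of the crux with a parameter `S` = set of admissible release phases: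
every weak solution of `∂ₜθ + u(s+·)·∇θ = κΔθ`, `θ(0) = h`, `s ∈ S`, obeys
`‖θ(t)‖² ≤ C e^{-γt} ‖h‖²` for a.e. `t ∈ (0,T)`. The crux is the case `S = Ici 0`. -/
def RelaxesUniformlyFrom (κ : ℝ) (u : ℝ → 𝕋² → E²) (h : 𝕋² → ℝ) (C γ : ℝ) (S : Set ℝ) : Prop :=
  ∀ s ∈ S, ∀ (T : ℝ) (θ : ℝ → 𝕋² → ℝ),
    Torus.IsWeakScalarTransportOn T κ (fun t => u (s + t)) h θ →
      ∀ᵐ t ∂(volume.restrict (Ioo (0 : ℝ) T)),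
        Torus.scalarL2Sq (θ t) ≤ C * Real.exp (-(γ * t)) * Torus.scalarL2Sq h

/-- **Transfer class `C⁺` of the line.** Exact time-periodic, point-symmetric states of the steadily
forced 2-D Navier–Stokes equations: a steady smooth solenoidal mean-zero point-odd force `g`, an odd
smooth mean-zero profile `h`, `ν_j → 0`, periods `0 < T_j ≤ T₀`, global Leray–Hopf solutions `v_j`
with `v_j (t + T_j) = v_j t`, `v_j t (-x) = -v_j t x`, local boundedness, POINTWISE energy `≤ E` on
`t ≥ 0`, the relaxation clause from the phases of ONE period with `ν`-uniform `(C, γ)`, and the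
absorption floor. (Verbatim the sketch's `RecurrentSymmetricStates`.) -/
def RecurrentSymmetricStates : Prop :=
  ∃ (g : 𝕋² → E²) (h : 𝕋² → ℝ), Torus.IsSmooth g ∧ Torus.IsDivFree g ∧ Torus.HasZeroMean g ∧
    (∀ x, g (-x) = -g x) ∧ Torus.IsSmooth h ∧ Torus.HasZeroMean h ∧ (∀ x, h (-x) = -h x) ∧
    ∃ (ν T : ℕ → ℝ) (T₀ E : ℝ) (v₀ : ℕ → 𝕋² → E²) (v : ℕ → ℝ → 𝕋² → E²),
      (∀ j, 0 < ν j) ∧ Tendsto ν atTop (nhds 0) ∧ (∀ j, 0 < T j ∧ T j ≤ T₀) ∧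
      (∀ j, Torus.IsGlobalLerayHopf (ν j) (fun _ => g) (v₀ j) (v j)) ∧
      (∀ j (T' : ℝ), 0 < T' →
        MemLp (Torus.stLift (v j)) ⊤ (volume.restrict (Ioo (0 : ℝ) T' ×ˢ univ))) ∧
      (∀ j, Function.Periodic (v j) (T j)) ∧
      (∀ j t x, v j t (-x) = -v j t x) ∧
      (∀ j t, 0 ≤ t → ∫⁻ x, ‖v j t x‖ₑ ^ 2 ≤ ENNReal.ofReal E) ∧
      (∃ C γ : ℝ, 0 ≤ C ∧ 0 < γ ∧ ∀ j, RelaxesUniformlyFrom (ν j) (v j) h C γ (Icc 0 (T j))) ∧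
      ∃ ε : ℝ, 0 < ε ∧ ∀ j, ∃ θ : ℝ → 𝕋² → ℝ,
        Torus.IsWeakScalarTransportForced (ν j) (v j) (fun _ => h) 0 θ ∧
        ε ≤ longTimeAvgSup (fun t => ν j * (Torus.eScalarGradNormSq (θ t)).toReal)

/-- The `(U_h)` clause asked of ONE weak solution per phase and horizon: from every release phase
`s ∈ S` and on every horizon `T > 0` SOME weak solution of `∂ₜθ + u(s+·)·∇θ = κΔθ`, `θ(0) = h`
obeys `‖θ(t)‖² ≤ C e^{-γt} ‖h‖²` for a.e. `t ∈ (0,T)`. For `κ > 0` and locally bounded drift this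
is equivalent to `RelaxesUniformlyFrom` (uniqueness; `relaxation_allSolutions_of_oneSolution`). -/
def RelaxesFromOneSolution (κ : ℝ) (u : ℝ → 𝕋² → E²) (h : 𝕋² → ℝ) (C γ : ℝ) (S : Set ℝ) : Prop :=
  ∀ s ∈ S, ∀ T : ℝ, 0 < T → ∃ θ : ℝ → 𝕋² → ℝ,
    Torus.IsWeakScalarTransportOn T κ (fun t => u (s + t)) h θ ∧
      ∀ᵐ t ∂(volume.restrict (Ioo (0 : ℝ) T)),
        Torus.scalarL2Sq (θ t) ≤ C * Real.exp (-(γ * t)) * Torus.scalarL2Sq h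

/-- **Reshaped transfer class `C⁺₁` (v3).** Verbatim `RecurrentSymmetricStates` except that the
one-period relaxation clause is `RelaxesFromOneSolution` (one weak solution per level, phase and
horizon) instead of `RelaxesUniformlyFrom` (every weak solution). -/
def RecurrentSymmetricStatesOne : Prop :=
  ∃ (g : 𝕋² → E²) (h : 𝕋² → ℝ), Torus.IsSmooth g ∧ Torus.IsDivFree g ∧ Torus.HasZeroMean g ∧
    (∀ x, g (-x) = -g x) ∧ Torus.IsSmooth h ∧ Torus.HasZeroMean h ∧ (∀ x, h (-x) = -h x) ∧
    ∃ (ν T : ℕ → ℝ) (T₀ E : ℝ) (v₀ : ℕ → 𝕋² → E²) (v : ℕ → ℝ → 𝕋² → E²),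
      (∀ j, 0 < ν j) ∧ Tendsto ν atTop (nhds 0) ∧ (∀ j, 0 < T j ∧ T j ≤ T₀) ∧
      (∀ j, Torus.IsGlobalLerayHopf (ν j) (fun _ => g) (v₀ j) (v j)) ∧
      (∀ j (T' : ℝ), 0 < T' →
        MemLp (Torus.stLift (v j)) ⊤ (volume.restrict (Ioo (0 : ℝ) T' ×ˢ univ))) ∧
      (∀ j, Function.Periodic (v j) (T j)) ∧
      (∀ j t x, v j t (-x) = -v j t x) ∧
      (∀ j t, 0 ≤ t → ∫⁻ x, ‖v j t x‖ₑ ^ 2 ≤ ENNReal.ofReal E) ∧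
      (∃ C γ : ℝ, 0 ≤ C ∧ 0 < γ ∧ ∀ j, RelaxesFromOneSolution (ν j) (v j) h C γ (Icc 0 (T j))) ∧
      ∃ ε : ℝ, 0 < ε ∧ ∀ j, ∃ θ : ℝ → 𝕋² → ℝ,
        Torus.IsWeakScalarTransportForced (ν j) (v j) (fun _ => h) 0 θ ∧
        ε ≤ longTimeAvgSup (fun t => ν j * (Torus.eScalarGradNormSq (θ t)).toReal)

/-! ## The stubs -/

/-- **Stub 1 — recurrent symmetric states, one-solution form (OPEN, HARDEST; the lead holds it).**
`C⁺₁`: exact time-periodic point-symmetric steadily forced planar Navier–Stokes states along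
`ν_j → 0` with pointwise bounded energy, ν-uniform one-period decay of ONE weak (= the energy)
solution released with the fixed odd profile from each phase of a period, and the absorbed-power
floor. Why plausibly true (card): sign-coherent two-phase vorticity of width `≍ 1/log(1/ν)` evades
the Pr = 1 lock; kinematically the Seis threshold is attainable at bounded energy (a log-fine shear
alternated with scale-`1/log` chaotic cells contracts the gravest odd mode by a fixed factor per
period at `|w| ≤ U`). Why it might fail: no exact recurrent NS state of this shape is known to
exist for a fixed steady `g` (large-deformation time-periodic patch states are beyond every printed
KAM theorem), and viscosity dynamically prefers the laminar member (Bardos–Titi–Wiedemann).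
Size: open problem in PDE. -/
theorem stub_recurrentSymmetricStatesOne : RecurrentSymmetricStatesOne := by
  sorry

/-- **Stub 2 — energy glue (KNOWN, size S; delegated).** A pointwise bound on the kinetic energy
on `t ≥ 0` in the `∫⁻ … ≤ ofReal E` form bounds the mean energy (`limsup` of Cesàro means of
`t ↦ ∫ ‖v t x‖²`) by `max E 0` (the `max` absorbs the degenerate `E < 0`, where the hypothesis forces
`v t = 0` a.e.). Proof route: `∫ ‖v t‖² = (∫⁻ ‖v t‖ₑ²).toReal ≤ max E 0` when the slice is
integrable, junk `0 ≤ max E 0` otherwise; then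
`Literature.Barriers.AnomalousDissipation.meanEnergy_le_of_forall_le`. -/
theorem stub_meanEnergyGlue :
    ∀ (v : ℝ → 𝕋² → E²) (E : ℝ), (∀ t, 0 ≤ t → ∫⁻ x, ‖v t x‖ₑ ^ 2 ≤ ENNReal.ofReal E) →
      meanEnergy v ≤ max E 0 :=
  -- LANDED: Theorems/LimitingAbsorptionUniformRelaxationWitnessStubMeanEnergyGlue.lean (p96702)
  Summit.AnomalousDissipation.AnomalousDissipation.Theorems.stub_meanEnergyGlue

/-! ## Proved glue: periodic phase reduction -/

/-- **Periodic phase reduction (proved).** For a `T₀`-periodic drift, `(U_h)` from the phases of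
one period `[0, T₀]` is `(U_h)` from every phase `s ≥ 0` with the SAME constants: the equation
released at phase `s` is literally the equation released at phase `s mod T₀`. -/
theorem periodicPhaseReduction {κ : ℝ} {u : ℝ → 𝕋² → E²} {h : 𝕋² → ℝ} {C γ T₀ : ℝ}
    (hT₀ : 0 < T₀) (hper : Function.Periodic u T₀)
    (hU : RelaxesUniformlyFrom κ u h C γ (Icc 0 T₀)) :
    RelaxesUniformlyFrom κ u h C γ (Ici 0) :=
  -- LANDED: Theorems/LimitingAbsorptionUniformRelaxationWitnessPeriodicTransfer.lean (p97288)
  fun s hs => Theorems.relaxation_allPhases_of_periodic κ u h C γ T₀ hT₀ hper hU s (Set.mem_Ici.1 hs)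

/-! ## Proved glue: one weak solution ⇒ every weak solution (bounded drift) -/

/-- **`(U_h)` for one weak solution is `(U_h)` for all (bounded drift; proved).** For `κ > 0` and a
drift essentially bounded on every `(0,T) × T²`, if from every release phase `s ∈ S ⊆ [0,∞)` and on
every horizon `T > 0` SOME weak solution released with datum `h` obeys the exponential bound a.e.,
then EVERY weak solution does: weak solutions in `L^∞_t L²_x` with bounded drift agree for a.e. `t`
(`KinematicSteadySourceLaw.ae_eq_of_memLp_top`, from the in-tree pointwise energy inequality), the
shifted drift stays bounded (`LapInventory.memLp_top_stLift_comp_const_add`), and `scalarL2Sq` only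
sees the a.e. class of a slice. (Registered sub-goal; Theorems-side copy:
`Theorems.relaxation_allSolutions_of_oneSolution`.) -/
theorem relaxation_allSolutions_of_oneSolution {κ : ℝ} {u : ℝ → 𝕋² → E²} {h : 𝕋² → ℝ}
    {C γ : ℝ} {S : Set ℝ} (hκ : 0 < κ) (hS : S ⊆ Ici 0)
    (hbd : ∀ T : ℝ, 0 < T → MemLp (Torus.stLift u) ⊤ (volume.restrict (Ioo (0 : ℝ) T ×ˢ univ)))
    (hOne : RelaxesFromOneSolution κ u h C γ S) : RelaxesUniformlyFrom κ u h C γ S := by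
  -- LANDED (∀-form): Theorems/LimitingAbsorptionUniformRelaxationWitnessOneSolutionGlue.lean (p98876),
  -- `Theorems.relaxation_allSolutions_of_oneSolution`; proof repeated here so the workfile does not wait
  -- on the farm build of that module.
  intro s hs T θ hθ
  rcases le_or_gt T 0 with hT | hT
  · rw [Set.Ioo_eq_empty (not_lt.2 hT), Measure.restrict_empty]
    rw [Filter.Eventually, MeasureTheory.ae_zero]; exact Filter.mem_bot
  obtain ⟨θ₁, hθ₁, hdec⟩ := hOne s hs T hT
  have hs0 : 0 ≤ s := hS hs
  have hu : MemLp (Torus.stLift (fun t => u (s + t))) ⊤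
      (volume.restrict (Ioo (0 : ℝ) T ×ˢ univ)) := by
    have := Theorems.LapInventory.memLp_top_stLift_comp_const_add (a := s) (T := s + T) hs0
      (hbd (s + T) (by linarith))
    simpa [add_sub_cancel_left] using this
  have hae := Theorems.KinematicSteadySourceLaw.ae_eq_of_memLp_top hκ hθ hθ₁ hu
  filter_upwards [hae, hdec] with t ht hbound
  have : Torus.scalarL2Sq (θ t) = Torus.scalarL2Sq (θ₁ t) := by
    unfold Torus.scalarL2Sq
    exact integral_congr_ae (ht.mono fun x hx => by simp [hx])
  rw [this]
  exact hbound

/-- **The card's `C⁺` from the reshaped stub (proved):** `RecurrentSymmetricStatesOne →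
RecurrentSymmetricStates`, level by level by `relaxation_allSolutions_of_oneSolution`
(`κ = ν_j > 0`, drift `v_j` locally bounded, phases `[0, T_j] ⊆ [0, ∞)`). -/
theorem recurrentSymmetricStates_of_one (H : RecurrentSymmetricStatesOne) :
    RecurrentSymmetricStates := by
  obtain ⟨g, h, hg, hgdiv, hgmean, hgodd, hh, hhmean, hhodd, ν, T, T₀, E, v₀, v, hν, hνlim, hT,
    hLH, hbd, hper, hvodd, hE, ⟨C, γ, hC, hγ, hU⟩, hfloor⟩ := H
  exact ⟨g, h, hg, hgdiv, hgmean, hgodd, hh, hhmean, hhodd, ν, T, T₀, E, v₀, v, hν, hνlim, hT,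
    hLH, hbd, hper, hvodd, hE, ⟨C, γ, hC, hγ, fun j =>
      relaxation_allSolutions_of_oneSolution (hν j) (fun s hs => Set.mem_Ici.2 hs.1) (hbd j)
        (hU j)⟩, hfloor⟩

/-- The card's `C⁺` (formerly stub 1, v1–v2), now DERIVED from the reshaped stub. -/
theorem recurrentSymmetricStates_of_line : RecurrentSymmetricStates :=
  recurrentSymmetricStates_of_one stub_recurrentSymmetricStatesOne

/-! ## The crux from the line -/

/-- **The crux from the line** — the ONLY theorem of this file concluding
`Summit.AnomalousDissipation.AnomalousDissipation.Theses.LimitingAbsorption.UniformRelaxationWitness`,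
BY NAME; no hypotheses; the registered stubs are INVOKED (sorries live only in `stub_*`).
Chain: `C⁺₁` (stub 1) ⟹ `C⁺` (`recurrentSymmetricStates_of_one`: one solution ⇒ all, bounded
drift) ⟹ per level, one-period `(U_h)` ⟹ all-phase `(U_h)` (`periodicPhaseReduction`); pointwise
energy ⟹ `meanEnergy ≤ max E 0` (stub 2, closed); everything else is carried over verbatim. -/
theorem UniformRelaxationWitness_of : UniformRelaxationWitness := by
  obtain ⟨g, h, hg, hgdiv, hgmean, -, hh, hhmean, -, ν, T, T₀, E, v₀, v, hν, hνlim, hT, hLH, hbd,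
    hper, -, hE, ⟨C, γ, hC, hγ, hU⟩, ε, hε, hfloor⟩ := recurrentSymmetricStates_of_line
  refine ⟨g, h, hg, hgdiv, hgmean, hh, hhmean, ν, v₀, v, hν, hνlim, hLH, hbd,
    ⟨max E 0, fun j => stub_meanEnergyGlue (v j) E (hE j)⟩, ⟨C, γ, hC, hγ, fun j s hs T' θ hθ => ?_⟩,
    ε, hε, hfloor⟩
  exact periodicPhaseReduction (hT j).1 (hper j) (hU j) s (Set.mem_Ici.2 hs) T' θ hθ

end Summit.AnomalousDissipation.AnomalousDissipation.Cruxes.UniformRelaxationWitness.Sketch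

end
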